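import Summits.NavierStokesRegularity.NavierStokesRegularity.Theorems.ExtremiserTransienceNearExtremalTransienceExtremiserLiouvilleConstantSpeedTruncationEnvelopes
import Mathlib.Analysis.SpecialFunctions.JapaneseBracket
import HarnessLib

/-!
# Crux `ExtremiserTransience.NearExtremalTransience` (stmt-NavierStokesRegularity-21883), line `extremiser_liouville`,
# stub K1b — THE MULTIPLIER IDENTITY FOR DECAYING SOLENOIDAL TEST FIELDS `Ψ = curl A`

`--supports stmt-NavierStokesRegularity-21883` (helper).  Author: prover seat `ns-el-k1b` (g6).

g3's KKT multiplier (`…ConstantSpeedMultiplierMeasure`) is the identity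
`S·J₁(φ) − κ⋆²M²(W a₁(φ) + Z c₁(φ)) = ∫⟪v, φ⟫dμ` for smooth COMPACTLY SUPPORTED divergence-free `φ`.  Here it is extended to the
decaying class `φ = curl A`, `A ∈ C^∞(ℝ³;ℝ³)` with `‖A(x)‖ ≤ C(1+‖x‖)⁻¹` and `‖DᵏA(x)‖ ≤ C(1+‖x‖)⁻²` (`k = 1,2,3`) — the class of
Newtonian vector potentials `A = Γ ∗ B`, `B ∈ C_c^∞` (next file) — by the solenoidal truncations `φ_ρ = curl(χ_ρ A)` (`χ_ρ` the
tree's `cutoff ρ`) and dominated convergence `ρ → ∞` in the four integrals: the truncations have `ρ`-uniform envelopes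
`‖φ_ρ‖ ≤ K`, `‖curl φ_ρ‖, ‖Dφ_ρ‖, ‖D curl φ_ρ‖ ≤ K(1+‖x‖)⁻²` (Leibniz for `Dᵏ(χ_ρ A)` + `‖Dⁱχ_ρ‖ ≲ (1+‖x‖)^{-i}` uniformly in
`ρ ≥ 1`), and agree with `curl A` on the ball of radius `ρ`.

(envelopes: `…ConstantSpeedTruncationEnvelopes`).
* `multiplierIdentity_curl_of_decay` : the identity for `φ = curl A`.
* `multiplierIdentity_curl_rescale_of_decay` : the identity for every rescaled field `(curl A)(R⁻¹·)`, `R ≥ 1` — the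
  hypothesis `hid` of `tendsto_blowDown_pairing_of_sqIntegrable` (`…ConstantSpeedBlowDownDecay`).

WHAT THIS IS NOT: K1b is NOT proved; nothing here proves NS regularity. [folklore]
-/

noncomputable section

open Set Filter Topology MeasureTheory Metric Function
open scoped ENNReal NNReal Topology InnerProductSpace RealInnerProductSpace ContDiff
open Literature.Analysis.FluidPDE Literature.Analysis

namespace Summit.NavierStokesRegularity.NavierStokesRegularity.Theorems

-- the problem directory repeats the summit name (`NavierStokesRegularity/NavierStokesRegularity`)
set_option linter.dupNamespace false

namespace ExtremiserLiouville

open DepletionLadder.KStar DepletionLadder.KStar.HalfSpace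
open Summit.NavierStokesRegularity.NavierStokesRegularity.Theorems.RungReynoldsOne.WeightedSlice

variable {A : E3 → E3}

/-! ## The extension theorem -/

variable {v : E3 → E3}

/-- The envelope `(1+‖x‖)⁻²` is square integrable on `ℝ³` (`(1+‖x‖)⁻⁴ ∈ L¹`, Japanese bracket). [folklore] -/
theorem integrable_inv_one_add_norm_sq_sq :
    Integrable (fun x : E3 => (((1 + ‖x‖) ^ 2)⁻¹) ^ 2) volume := by
  have h := (integrable_one_add_norm (E := E3) (μ := volume) (r := 4)
    (by rw [finrank_euclideanSpace, Fintype.card_fin]; norm_num))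
  refine h.congr (Eventually.of_forall fun x => ?_)
  have hx : 0 < 1 + ‖x‖ := by positivity
  show (1 + ‖x‖) ^ (-4 : ℝ) = (((1 + ‖x‖) ^ 2)⁻¹) ^ 2
  rw [Real.rpow_neg hx.le, show (4 : ℝ) = ((4 : ℕ) : ℝ) by norm_num, Real.rpow_natCast, ← inv_pow, ← inv_pow, ← pow_mul]

/-- **The multiplier identity for decaying solenoidal test fields `φ = curl A`.**  Let `v` be smooth with `‖v‖ ≡ M`,
`D¹v, D²v ∈ L²`, `μ` finite with g3's multiplier identity for smooth compactly supported divergence-free `φ`.  Let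
`A ∈ C^∞(ℝ³;ℝ³)` with `‖A(x)‖ ≤ C(1+‖x‖)⁻¹` and `‖DᵏA(x)‖ ≤ C(1+‖x‖)⁻²` for `k = 1,2,3`.  Then
`S·J₁(curl A) − κ⋆²M²(W a₁(curl A) + Z c₁(curl A)) = ∫⟪v, curl A⟫dμ`. [folklore] -/
theorem multiplierIdentity_curl_of_decay (hv : ContDiff ℝ ∞ v) {M : ℝ} (hM : ∀ x, ‖v x‖ = M)
    (h1 : ∫⁻ x, ‖iteratedFDeriv ℝ 1 v x‖ₑ ^ 2 < ⊤) (h2 : ∫⁻ x, ‖iteratedFDeriv ℝ 2 v x‖ₑ ^ 2 < ⊤)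
    (μ : Measure E3) [IsFiniteMeasure μ]
    (hμ : ∀ φ : E3 → E3, ContDiff ℝ ∞ φ → HasCompactSupport φ → VectorCalculus.IsDivFree φ →
      Jst v * J1 v φ - kStar ^ 2 * M ^ 2 * (Wpa v * A1 v φ + Zen v * C1 v φ) = ∫ x, ⟪v x, φ x⟫_ℝ ∂μ)
    (hA : ContDiff ℝ ∞ A) {C : ℝ} (hA0 : ∀ x, ‖A x‖ ≤ C * (1 + ‖x‖)⁻¹)
    (hAk : ∀ k : ℕ, 1 ≤ k → k ≤ 3 → ∀ x, ‖iteratedFDeriv ℝ k A x‖ ≤ C * ((1 + ‖x‖) ^ 2)⁻¹) :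
    Jst v * J1 v (curl A) - kStar ^ 2 * M ^ 2 * (Wpa v * A1 v (curl A) + Zen v * C1 v (curl A)) =
      ∫ x, ⟪v x, curl A x⟫_ℝ ∂μ := by
  obtain ⟨c, hc1, hc⟩ := exists_norm_iteratedFDeriv_cutoff_le
  have hC0 : 0 ≤ C := by
    have h := hA0 0
    have : 0 < (1 + ‖(0 : E3)‖)⁻¹ := by positivity
    nlinarith [norm_nonneg (A 0)]
  set κ : ℝ := ‖curlCLM‖ with hκ
  have hκ0 : 0 ≤ κ := by rw [hκ]; exact norm_nonneg curlCLM
  set K : ℝ := 8 * c * C with hK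
  have hK0 : 0 ≤ K := by positivity
  set B₁ : ℝ := (1 + κ) ^ 2 * K with hB₁
  have hB₁0 : 0 ≤ B₁ := by positivity
  have hκB : κ * K ≤ B₁ := by rw [hB₁]; nlinarith [hκ0, hK0]
  have hκ2B : κ * (κ * K) ≤ B₁ := by rw [hB₁]; nlinarith [hκ0, hK0]
  -- the envelope
  set E : E3 → ℝ := fun x => ((1 + ‖x‖) ^ 2)⁻¹ with hE
  have hE0 : ∀ x, 0 ≤ E x := fun x => by positivity
  have hE1 : ∀ x, E x ≤ 1 := fun x => by
    rw [hE]; exact inv_le_one_of_one_le₀ (one_le_pow₀ (by linarith [norm_nonneg x]))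
  have hEi : Integrable (fun x => E x ^ 2) volume := integrable_inv_one_add_norm_sq_sq
  -- the truncations
  set T : ℕ → E3 → E3 := fun n y => cutoff ((n : ℝ) + 1) y • A y with hT
  set φ : ℕ → E3 → E3 := fun n => curl (T n) with hφ
  have hρ1 : ∀ n : ℕ, (1 : ℝ) ≤ (n : ℝ) + 1 := fun n => by simp
  have hρ0 : ∀ n : ℕ, (0 : ℝ) < (n : ℝ) + 1 := fun n => by positivity
  have hTs : ∀ n, ContDiff ℝ ∞ (T n) := fun n => (contDiff_cutoff _).smul hA
  have hTc : ∀ n, HasCompactSupport (T n) := fun n => (hasCompactSupport_cutoff (hρ0 n)).smul_right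
  have hφs : ∀ n, ContDiff ℝ ∞ (φ n) := fun n => contDiff_curl (n := ⊤) (by exact_mod_cast hTs n)
  have hφc : ∀ n, HasCompactSupport (φ n) := fun n => hasCompactSupport_curl (hTc n)
  have hφdiv : ∀ n, VectorCalculus.IsDivFree (φ n) := fun n x =>
    divergence_curl_eq_zero_holds (T n) ((hTs n).of_le (by norm_cast)) x
  have hid : ∀ n, Jst v * J1 v (φ n) - kStar ^ 2 * M ^ 2 * (Wpa v * A1 v (φ n) + Zen v * C1 v (φ n)) =
      ∫ x, ⟪v x, φ n x⟫_ℝ ∂μ := fun n => hμ (φ n) (hφs n) (hφc n) (hφdiv n)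
  -- envelopes of the truncations
  have henv : ∀ n, ∀ k : ℕ, 1 ≤ k → k ≤ 3 → ∀ x, ‖iteratedFDeriv ℝ k (T n) x‖ ≤ K * E x := fun n k hk1 hk3 x =>
    norm_iteratedFDeriv_cutoff_smul_le hA hA0 hAk hc1 hc (hρ1 n) hk1 hk3 x
  have hb0 : ∀ n x, ‖φ n x‖ ≤ B₁ := fun n x => by
    have h := norm_iteratedFDeriv_curl_le (hTs n) 0 x
    rw [norm_iteratedFDeriv_zero] at h
    calc ‖φ n x‖ ≤ κ * ‖iteratedFDeriv ℝ 1 (T n) x‖ := h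
      _ ≤ κ * (K * E x) := mul_le_mul_of_nonneg_left (henv n 1 le_rfl (by norm_num) x) hκ0
      _ ≤ κ * K := mul_le_mul_of_nonneg_left (mul_le_of_le_one_right hK0 (hE1 x)) hκ0
      _ ≤ B₁ := hκB
  have hb1 : ∀ n x, ‖fderiv ℝ (φ n) x‖ ≤ B₁ * E x := fun n x => by
    have h := norm_iteratedFDeriv_curl_le (hTs n) 1 x
    rw [← norm_fderiv_eq_norm_iteratedFDeriv_one] at h
    calc ‖fderiv ℝ (φ n) x‖ ≤ κ * ‖iteratedFDeriv ℝ 2 (T n) x‖ := h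
      _ ≤ κ * (K * E x) := mul_le_mul_of_nonneg_left (henv n 2 (by norm_num) (by norm_num) x) hκ0
      _ = (κ * K) * E x := by ring
      _ ≤ B₁ * E x := mul_le_mul_of_nonneg_right hκB (hE0 x)
  have hb2 : ∀ n x, ‖curl (φ n) x‖ ≤ B₁ * E x := fun n x => by
    have h := norm_iteratedFDeriv_curl_le (hφs n) 0 x
    rw [norm_iteratedFDeriv_zero] at h
    have h' := norm_iteratedFDeriv_curl_le (hTs n) 1 x
    calc ‖curl (φ n) x‖ ≤ κ * ‖iteratedFDeriv ℝ 1 (φ n) x‖ := h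
      _ ≤ κ * (κ * ‖iteratedFDeriv ℝ 2 (T n) x‖) := mul_le_mul_of_nonneg_left h' hκ0
      _ ≤ κ * (κ * (K * E x)) :=
          mul_le_mul_of_nonneg_left (mul_le_mul_of_nonneg_left (henv n 2 (by norm_num) (by norm_num) x) hκ0) hκ0
      _ = (κ * (κ * K)) * E x := by ring
      _ ≤ B₁ * E x := mul_le_mul_of_nonneg_right hκ2B (hE0 x)
  have hb3 : ∀ n x, ‖fderiv ℝ (curl (φ n)) x‖ ≤ B₁ * E x := fun n x => by
    have h := norm_iteratedFDeriv_curl_le (hφs n) 1 x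
    rw [← norm_fderiv_eq_norm_iteratedFDeriv_one] at h
    have h' := norm_iteratedFDeriv_curl_le (hTs n) 2 x
    calc ‖fderiv ℝ (curl (φ n)) x‖ ≤ κ * ‖iteratedFDeriv ℝ 2 (φ n) x‖ := h
      _ ≤ κ * (κ * ‖iteratedFDeriv ℝ 3 (T n) x‖) := mul_le_mul_of_nonneg_left h' hκ0
      _ ≤ κ * (κ * (K * E x)) :=
          mul_le_mul_of_nonneg_left (mul_le_mul_of_nonneg_left (henv n 3 (by norm_num) le_rfl x) hκ0) hκ0
      _ = (κ * (κ * K)) * E x := by ring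
      _ ≤ B₁ * E x := mul_le_mul_of_nonneg_right hκ2B (hE0 x)
  -- local agreement: eventually in `n`, `φ n`, `curl (φ n)`, `D(φ n)`, `D curl(φ n)` at `x` are those of `curl A`
  have hloc : ∀ x : E3, ∀ᶠ n : ℕ in atTop, φ n x = curl A x ∧ curl (φ n) x = curl (curl A) x ∧
      fderiv ℝ (φ n) x = fderiv ℝ (curl A) x ∧ fderiv ℝ (curl (φ n)) x = fderiv ℝ (curl (curl A)) x := by
    intro x
    filter_upwards [tendsto_natCast_atTop_atTop.eventually_gt_atTop ‖x‖] with n hn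
    set U : Set E3 := ball (0 : E3) ((n : ℝ) + 1) with hU
    have hUo : IsOpen U := isOpen_ball
    have hxU : x ∈ U := by rw [hU, mem_ball_zero_iff]; linarith
    have hTA : EqOn (T n) A U := fun y hy => by
      have hy' : ‖y‖ ≤ (n : ℝ) + 1 := (mem_ball_zero_iff.1 hy).le
      show cutoff ((n : ℝ) + 1) y • A y = A y
      rw [cutoff_eq_one (hρ0 n) hy', one_smul]
    obtain ⟨-, hφA⟩ := eqOn_fderiv_curl_of_isOpen hUo hTA
    obtain ⟨hDφ, hcφ⟩ := eqOn_fderiv_curl_of_isOpen hUo hφA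
    obtain ⟨hDcφ, -⟩ := eqOn_fderiv_curl_of_isOpen hUo hcφ
    exact ⟨hφA hxU, hcφ hxU, hDφ hxU, hDcφ hxU⟩
  -- integrability of the three global densities of `v`
  have IZ : Integrable (fun x => ‖curl v x‖ ^ 2) volume := (integrable_norm_curl_sq (hv.of_le (by norm_cast)) h1).1
  have IW : Integrable (fun x => frobeniusNormSq (fderiv ℝ (curl v) x)) volume :=
    (integrable_frobeniusNormSq_fderiv_curl (hv.of_le (by norm_cast)) h2).1
  have ID : Integrable (fun x => ‖fderiv ℝ v x‖ ^ 2) volume := by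
    have h1' : ∫⁻ x, ‖fderiv ℝ v x‖ₑ ^ 2 < ⊤ := by
      refine lt_of_le_of_lt (le_of_eq (lintegral_congr fun x => ?_)) h1
      rw [← ofReal_norm, ← ofReal_norm, norm_iteratedFDeriv_one]
    exact integrable_sq_norm_of_lintegral_lt_top (hv.continuous_fderiv (by simp)) h1'
  -- continuity facts
  have hcv : Continuous (curl v) := continuous_curl (hv.of_le (by norm_cast))
  have hDv : Continuous (fderiv ℝ v) := hv.continuous_fderiv (by simp)
  have hDcv : Continuous (fderiv ℝ (curl v)) :=
    (contDiff_curl (n := ⊤) (by exact_mod_cast hv)).continuous_fderiv (by simp)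
  have hcφn : ∀ n, Continuous (curl (φ n)) := fun n => continuous_curl ((hφs n).of_le (by norm_cast))
  have hDφn : ∀ n, Continuous (fderiv ℝ (φ n)) := fun n => (hφs n).continuous_fderiv (by simp)
  have hDcφn : ∀ n, Continuous (fderiv ℝ (curl (φ n))) := fun n =>
    (contDiff_curl (n := ⊤) (by exact_mod_cast hφs n)).continuous_fderiv (by simp)
  -- (L1) the `J₁` integrals
  have LJ : Tendsto (fun n => J1 v (φ n)) atTop (𝓝 (J1 v (curl A))) := by
    unfold J1
    refine tendsto_integral_of_dominated_convergence (fun x => B₁ * (‖fderiv ℝ v x‖ ^ 2 + 2 * ‖curl v x‖ ^ 2))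
      (fun n => ?_) ((ID.add (IZ.const_mul 2)).const_mul B₁) (fun n => Eventually.of_forall fun x => ?_) ?_
    · exact ((((hcφn n).inner (hDv.clm_apply hcv)).add (hcv.inner ((hDφn n).clm_apply hcv))).add
        (hcv.inner (hDv.clm_apply (hcφn n)))).aestronglyMeasurable
    · set a := ‖fderiv ℝ v x‖ with ha_def
      set b := ‖curl v x‖ with hb_def
      have ha : 0 ≤ a := norm_nonneg _
      have hb : 0 ≤ b := norm_nonneg _
      have hBE : B₁ * E x ≤ B₁ := by nlinarith [hE1 x, hB₁0]
      have hcφ : ‖curl (φ n) x‖ ≤ B₁ := (hb2 n x).trans hBE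
      have hDφ : ‖fderiv ℝ (φ n) x‖ ≤ B₁ := (hb1 n x).trans hBE
      rw [Real.norm_eq_abs]
      have t1 : |⟪curl (φ n) x, fderiv ℝ v x (curl v x)⟫| ≤ B₁ * (a * b) := by
        refine (abs_real_inner_le_norm _ _).trans ?_
        exact mul_le_mul hcφ ((fderiv ℝ v x).le_opNorm _) (norm_nonneg _) hB₁0
      have t2 : |⟪curl v x, fderiv ℝ (φ n) x (curl v x)⟫| ≤ B₁ * (b * b) := by
        refine (abs_real_inner_le_norm _ _).trans ?_
        calc ‖curl v x‖ * ‖fderiv ℝ (φ n) x (curl v x)‖ ≤ b * (B₁ * b) :=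
              mul_le_mul_of_nonneg_left (((fderiv ℝ (φ n) x).le_opNorm _).trans (mul_le_mul_of_nonneg_right hDφ hb)) hb
          _ = B₁ * (b * b) := by ring
      have t3 : |⟪curl v x, fderiv ℝ v x (curl (φ n) x)⟫| ≤ B₁ * (a * b) := by
        refine (abs_real_inner_le_norm _ _).trans ?_
        calc ‖curl v x‖ * ‖fderiv ℝ v x (curl (φ n) x)‖ ≤ b * (a * B₁) :=
              mul_le_mul_of_nonneg_left (((fderiv ℝ v x).le_opNorm _).trans (mul_le_mul_of_nonneg_left hcφ ha)) hb
          _ = B₁ * (a * b) := by ring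
      have hsum := (abs_add_le _ _).trans (add_le_add ((abs_add_le _ _).trans (add_le_add t1 t2)) t3)
      have hab : 2 * (a * b) + b * b ≤ a ^ 2 + 2 * b ^ 2 := by nlinarith [two_mul_le_add_sq a b]
      calc |⟪curl (φ n) x, fderiv ℝ v x (curl v x)⟫ + ⟪curl v x, fderiv ℝ (φ n) x (curl v x)⟫ +
            ⟪curl v x, fderiv ℝ v x (curl (φ n) x)⟫|
          ≤ B₁ * (a * b) + B₁ * (b * b) + B₁ * (a * b) := hsum
        _ = B₁ * (2 * (a * b) + b * b) := by ring
        _ ≤ B₁ * (a ^ 2 + 2 * b ^ 2) := mul_le_mul_of_nonneg_left hab hB₁0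
    · refine Eventually.of_forall fun x => tendsto_const_nhds.congr' ?_
      filter_upwards [hloc x] with n hn
      rw [hn.2.1, hn.2.2.1]
  -- (L2) the `a₁` integrals
  have LA : Tendsto (fun n => A1 v (φ n)) atTop (𝓝 (A1 v (curl A))) := by
    unfold A1
    refine tendsto_integral_of_dominated_convergence (fun x => (‖curl v x‖ ^ 2 + (B₁ * E x) ^ 2) / 2)
      (fun n => ?_) ((IZ.add ((hEi.const_mul (B₁ ^ 2)).congr (Eventually.of_forall fun x => by ring))).div_const 2)
      (fun n => Eventually.of_forall fun x => ?_) ?_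
    · exact (hcv.inner (hcφn n)).aestronglyMeasurable
    · rw [Real.norm_eq_abs]
      refine (abs_real_inner_le_norm _ _).trans ?_
      have h := hb2 n x
      nlinarith [sq_nonneg (‖curl v x‖ - B₁ * E x), norm_nonneg (curl v x), norm_nonneg (curl (φ n) x)]
    · refine Eventually.of_forall fun x => tendsto_const_nhds.congr' ?_
      filter_upwards [hloc x] with n hn
      rw [hn.2.1]
  -- (L3) the `c₁` integrals
  have LC : Tendsto (fun n => C1 v (φ n)) atTop (𝓝 (C1 v (curl A))) := by
    unfold C1
    refine tendsto_integral_of_dominated_convergence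
      (fun x => 1 / 2 * frobeniusNormSq (fderiv ℝ (curl v) x) + 1 / (2 * 1) * (3 * (B₁ * E x) ^ 2))
      (fun n => ?_) ((IW.const_mul _).add (((hEi.const_mul (3 * B₁ ^ 2)).congr
        (Eventually.of_forall fun x => by ring)).const_mul _))
      (fun n => Eventually.of_forall fun x => ?_) ?_
    · exact (continuous_finsetSum _ fun i _ =>
        (hDcv.clm_apply continuous_const).inner ((hDcφn n).clm_apply continuous_const)).aestronglyMeasurable
    · rw [Real.norm_eq_abs]
      refine (sum_inner_le_frobeniusNormSq (fderiv ℝ (curl v) x) (fderiv ℝ (curl (φ n)) x) one_pos).trans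
        (add_le_add le_rfl (mul_le_mul_of_nonneg_left ?_ (by norm_num)))
      refine (BradshawTsai2017.frobeniusNormSq_le_three_mul_norm_sq _).trans ?_
      have h := hb3 n x
      have h0 : 0 ≤ ‖fderiv ℝ (curl (φ n)) x‖ := norm_nonneg _
      nlinarith [h, h0]
    · refine Eventually.of_forall fun x => tendsto_const_nhds.congr' ?_
      filter_upwards [hloc x] with n hn
      rw [hn.2.2.2]
  -- (L4) the multiplier side
  have Lμ : Tendsto (fun n => ∫ x, ⟪v x, φ n x⟫_ℝ ∂μ) atTop (𝓝 (∫ x, ⟪v x, curl A x⟫_ℝ ∂μ)) := by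
    refine tendsto_integral_of_dominated_convergence (fun _ => M * B₁)
      (fun n => ?_) (integrable_const _) (fun n => Eventually.of_forall fun x => ?_) ?_
    · exact (hv.continuous.inner (hφs n).continuous).aestronglyMeasurable
    · rw [Real.norm_eq_abs]
      refine (abs_real_inner_le_norm _ _).trans ?_
      rw [hM x]
      exact mul_le_mul_of_nonneg_left (hb0 n x) (by rw [← hM x]; exact norm_nonneg _)
    · refine Eventually.of_forall fun x => tendsto_const_nhds.congr' ?_
      filter_upwards [hloc x] with n hn
      rw [hn.1]
  -- pass to the limit in the identity
  have Llhs : Tendsto (fun n => Jst v * J1 v (φ n) - kStar ^ 2 * M ^ 2 * (Wpa v * A1 v (φ n) + Zen v * C1 v (φ n)))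
      atTop (𝓝 (Jst v * J1 v (curl A) - kStar ^ 2 * M ^ 2 * (Wpa v * A1 v (curl A) + Zen v * C1 v (curl A)))) :=
    (LJ.const_mul _).sub (((LA.const_mul _).add (LC.const_mul _)).const_mul _)
  have e : (fun n => Jst v * J1 v (φ n) - kStar ^ 2 * M ^ 2 * (Wpa v * A1 v (φ n) + Zen v * C1 v (φ n))) =
      fun n => ∫ x, ⟪v x, φ n x⟫_ℝ ∂μ := funext hid
  rw [e] at Llhs
  exact tendsto_nhds_unique Llhs Lμ

/-- **The multiplier identity for every rescaled field `(curl A)(R⁻¹·)`, `R ≥ 1`** — the hypothesis `hid` of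
`tendsto_blowDown_pairing_of_sqIntegrable`. [folklore] -/
theorem multiplierIdentity_curl_rescale_of_decay (hv : ContDiff ℝ ∞ v) {M : ℝ} (hM : ∀ x, ‖v x‖ = M)
    (h1 : ∫⁻ x, ‖iteratedFDeriv ℝ 1 v x‖ₑ ^ 2 < ⊤) (h2 : ∫⁻ x, ‖iteratedFDeriv ℝ 2 v x‖ₑ ^ 2 < ⊤)
    (μ : Measure E3) [IsFiniteMeasure μ]
    (hμ : ∀ φ : E3 → E3, ContDiff ℝ ∞ φ → HasCompactSupport φ → VectorCalculus.IsDivFree φ →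
      Jst v * J1 v φ - kStar ^ 2 * M ^ 2 * (Wpa v * A1 v φ + Zen v * C1 v φ) = ∫ x, ⟪v x, φ x⟫_ℝ ∂μ)
    (hA : ContDiff ℝ ∞ A) {C : ℝ} (hA0 : ∀ x, ‖A x‖ ≤ C * (1 + ‖x‖)⁻¹)
    (hAk : ∀ k : ℕ, 1 ≤ k → k ≤ 3 → ∀ x, ‖iteratedFDeriv ℝ k A x‖ ≤ C * ((1 + ‖x‖) ^ 2)⁻¹) {R : ℝ} (hR : 1 ≤ R) :
    Jst v * J1 v (fun y => curl A (R⁻¹ • y)) -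
        kStar ^ 2 * M ^ 2 * (Wpa v * A1 v (fun y => curl A (R⁻¹ • y)) + Zen v * C1 v (fun y => curl A (R⁻¹ • y))) =
      ∫ x, ⟪v x, curl A (R⁻¹ • x)⟫_ℝ ∂μ := by
  obtain ⟨hs, hb0, hbk, hcurl⟩ := rescale_decay hA hA0 hAk hR
  have h := multiplierIdentity_curl_of_decay hv hM h1 h2 μ hμ hs hb0 hbk
  rw [hcurl] at h
  exact h

end ExtremiserLiouville

end Summit.NavierStokesRegularity.NavierStokesRegularity.Theorems

end
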